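import Literature.Probability.RandomPlanarGeometry.StochasticSqueeze
import Literature.MeasureTheory.RandomSets.AvoidanceFunctional
import HarnessLib

/-!
# The two-sided stochastic squeeze seen through a monotone random-compact-set statistic

Topic `Literature/Probability/RandomPlanarGeometry`, third part of the abstract squeeze toolkit
(`StochDominatedLimit.lean`: the Hall/Strassen order along a closed relation passes to weak limits;
`StochasticSqueeze.lean`: sequential forms, antisymmetry on a π-system of up-sets, pull-back
through an a.s.-injective statistic).  Here the three steps are assembled in the form needed for
random CHORDS ordered left–right: the order `R` on the chord space `X` is only known to make a
compact-set-valued statistic `Φ : X → NonemptyCompacts α` (a side region, the trace, a hull)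
monotone, and `Φ` is injective on a measurable set `S` carrying the laws in question (e.g. simple
chords are determined by their side region).  Then a probability law `μ` squeezed between
`lo n ≼_R μ ≼_R hi n` with `lo n, hi n → λ` weakly equals `λ`
(`measure_eq_of_squeeze_of_monotone_map`, `…_of_antitone_map`): step (1) gives
`λ ≼_R μ ≼_R λ` on measurable sets, the `Φ`-preimages of the joint hit events (resp. miss events)
of open sets are measurable `R`-up-sets, so `μ.map Φ = λ.map Φ` by the uniqueness half of the
Choquet–Kendall–Matheron theorem (`Literature.MeasureTheory.RandomSets`), and step (3) pulls the
identification back to `X`.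

## Contents

* `isPiSystem_setOf_forall_hits`, `measurableSpace_eq_generateFrom_setOf_forall_hits`,
  `nonemptyCompacts_ext_of_forall_hits` — the JOINT HIT events `{K | ∀ U ∈ F, K ∩ U ≠ ∅}` of
  finitely many open sets form a generating π-system of the Borel σ-algebra of
  `NonemptyCompacts α` (they are up-sets for `⊆`; the miss events of `AvoidanceFunctional.lean`
  are up-sets for `⊇`), hence determine finite measures.
* `nonemptyCompacts_measure_eq_of_dominated_of_dominated[']` — antisymmetry of the Hall order
  for random compact sets, along `⊇` (miss events) and along `⊆` (joint hit events).
* `measure_eq_of_dominated_of_monotone_map`, `…_of_antitone_map` — steps (2)+(3): two-sided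
  domination on measurable sets + a monotone/antitone statistic injective on a carrying set ⇒
  equality of the laws.
* `measure_eq_of_squeeze_of_monotone_map`, `measure_eq_of_squeeze_of_antitone_map` — the
  assembled squeeze through a statistic (fixed closed relation `R`);
  `measure_eq_of_squeeze_of_monotone_map_of_antitone`, `…_of_antitone_map_of_antitone` — the same
  with stage-dependent relations asymptotically inside a decreasing sequence of closed relations
  (targets `bₙ → b`).

## References

* I. Molchanov, *Theory of Random Sets* (2005), Chap. 1, §1.6 and Thm. 1.13 (the capacity /
  avoidance functional determines the law) [Molchanov2005].
* T. Kamae, U. Krengel, G. L. O'Brien, Ann. Probab. 5 (1977), 899–912 (stochastic order and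
  weak convergence).
-/

noncomputable section

open MeasureTheory Filter Set Metric TopologicalSpace
open scoped Topology ENNReal NNReal BoundedContinuousFunction

namespace Literature.Probability.RandomPlanarGeometry

/-! ### Joint hit events of finitely many open sets -/

section HitEvents

variable {α : Type*} [TopologicalSpace α]

/-- **The joint hit events `{K | ∀ U ∈ F, K ∩ U ≠ ∅}` (`F` a finite family of open sets) form a
π-system** (concatenate the families). [folklore] -/
theorem isPiSystem_setOf_forall_hits :
    IsPiSystem {E : Set (NonemptyCompacts α) | ∃ F : Finset (Set α), (∀ U ∈ F, IsOpen U) ∧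
      E = {K : NonemptyCompacts α | ∀ U ∈ F, ((K : Set α) ∩ U).Nonempty}} := by
  classical
  rintro _ ⟨F, hF, rfl⟩ _ ⟨G, hG, rfl⟩ _
  refine ⟨F ∪ G, fun U hU => ?_, ?_⟩
  · rcases Finset.mem_union.1 hU with h | h
    exacts [hF U h, hG U h]
  · ext K
    simp only [mem_inter_iff, mem_setOf_eq, Finset.mem_union, or_imp, forall_and]

end HitEvents

section HitEventsMeasure

variable {α : Type*} [PseudoEMetricSpace α] [SecondCountableTopology α]
  [MeasurableSpace (NonemptyCompacts α)] [BorelSpace (NonemptyCompacts α)]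

/-- **The joint hit events of finitely many open sets generate the Borel σ-algebra of the
hyperspace** `NonemptyCompacts α` (`α` second-countable pseudo-emetric): each miss event
`{K ∩ U = ∅}` is the complement of the hit event of `U`, and the miss events generate
(`Literature.MeasureTheory.RandomSets.borel_eq_generateFrom_setOf_disjoint`); conversely joint hit
events are finite intersections of complements of (closed) miss events.
[cite: Molchanov2005, App. C, Thm. C.5 (iii)] -/
theorem measurableSpace_eq_generateFrom_setOf_forall_hits :
    ‹MeasurableSpace (NonemptyCompacts α)› = MeasurableSpace.generateFrom
      {E : Set (NonemptyCompacts α) | ∃ F : Finset (Set α), (∀ U ∈ F, IsOpen U) ∧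
        E = {K : NonemptyCompacts α | ∀ U ∈ F, ((K : Set α) ∩ U).Nonempty}} := by
  classical
  refine le_antisymm ?_ (MeasurableSpace.generateFrom_le ?_)
  · rw [BorelSpace.measurable_eq (α := NonemptyCompacts α),
      Literature.MeasureTheory.RandomSets.borel_eq_generateFrom_setOf_disjoint]
    refine MeasurableSpace.generateFrom_le ?_
    rintro _ ⟨U, hU, rfl⟩
    have hEq : {K : NonemptyCompacts α | Disjoint (K : Set α) U} =
        {K : NonemptyCompacts α | ∀ U' ∈ ({U} : Finset (Set α)), ((K : Set α) ∩ U').Nonempty}ᶜ := by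
      ext K
      simp only [mem_setOf_eq, Finset.mem_singleton, forall_eq, mem_compl_iff,
        not_nonempty_iff_eq_empty, disjoint_iff_inter_eq_empty]
    rw [hEq]
    refine MeasurableSet.compl ?_
    exact MeasurableSpace.measurableSet_generateFrom ⟨{U}, by simpa using hU, rfl⟩
  · rintro _ ⟨F, hF, rfl⟩
    have hEq : {K : NonemptyCompacts α | ∀ U ∈ F, ((K : Set α) ∩ U).Nonempty} =
        ⋂ U ∈ F, {K : NonemptyCompacts α | Disjoint (K : Set α) U}ᶜ := by
      ext K
      simp only [mem_setOf_eq, mem_iInter, mem_compl_iff, disjoint_iff_inter_eq_empty,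
        nonempty_iff_ne_empty, ne_eq]
    rw [hEq]
    exact Finset.measurableSet_biInter F fun U hU =>
      (Literature.MeasureTheory.RandomSets.measurableSet_setOf_disjoint (hF U hU)).compl

/-- **Joint hit probabilities determine a finite Borel measure on `NonemptyCompacts α`**: two
finite measures with the same mass agreeing on all joint hit events of finitely many open sets are
equal (π-system uniqueness). [cite: Molchanov2005, Chap. 1, §1.6 (Def. 1.32) and Thm. 1.13] -/
theorem nonemptyCompacts_ext_of_forall_hits (μ ν : Measure (NonemptyCompacts α)) [IsFiniteMeasure μ]
    (huniv : μ univ = ν univ)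
    (h : ∀ F : Finset (Set α), (∀ U ∈ F, IsOpen U) →
      μ {K : NonemptyCompacts α | ∀ U ∈ F, ((K : Set α) ∩ U).Nonempty} =
        ν {K : NonemptyCompacts α | ∀ U ∈ F, ((K : Set α) ∩ U).Nonempty}) :
    μ = ν := by
  refine ext_of_generate_finite _ measurableSpace_eq_generateFrom_setOf_forall_hits
    isPiSystem_setOf_forall_hits ?_ huniv
  rintro _ ⟨F, hF, rfl⟩
  exact h F hF

/-! ### Antisymmetry of the Hall order for random compact sets -/

/-- **Antisymmetry along reverse inclusion (miss events).** Two finite Borel measures on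
`NonemptyCompacts α` with the same mass, each dominated by the other in Hall form along `⊇` on the
miss events — `μ {K | K ∩ U = ∅} ≤ ν {K' | ∃ K, K ∩ U = ∅ ∧ K' ⊆ K}` for `U` open, and
symmetrically — are equal: miss events of open sets are up-sets for `⊇`, form a π-system and
generate the Borel σ-algebra (uniqueness half of Choquet–Kendall–Matheron). [folklore] -/
theorem nonemptyCompacts_measure_eq_of_dominated_of_dominated
    {μ ν : Measure (NonemptyCompacts α)} [IsFiniteMeasure μ] (huniv : μ univ = ν univ)
    (h₁ : ∀ U : Set α, IsOpen U →
      μ {K : NonemptyCompacts α | Disjoint (K : Set α) U} ≤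
        ν {K' | ∃ K ∈ {K : NonemptyCompacts α | Disjoint (K : Set α) U}, (K' : Set α) ⊆ K})
    (h₂ : ∀ U : Set α, IsOpen U →
      ν {K : NonemptyCompacts α | Disjoint (K : Set α) U} ≤
        μ {K' | ∃ K ∈ {K : NonemptyCompacts α | Disjoint (K : Set α) U}, (K' : Set α) ⊆ K}) :
    μ = ν := by
  refine measure_eq_of_dominated_of_dominated_on_piSystem
    (r := fun K K' : NonemptyCompacts α => (K' : Set α) ⊆ K) _ ?_
    Literature.MeasureTheory.RandomSets.isPiSystem_setOf_disjoint ?_ huniv ?_ ?_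
  · rw [← Literature.MeasureTheory.RandomSets.borel_eq_generateFrom_setOf_disjoint]
    exact BorelSpace.measurable_eq
  · rintro _ ⟨U, -, rfl⟩ K K' hK hKK'
    exact Disjoint.mono_left hKK' hK
  · rintro _ ⟨U, hU, rfl⟩
    exact h₁ U hU
  · rintro _ ⟨U, hU, rfl⟩
    exact h₂ U hU

/-- **Antisymmetry along inclusion (joint hit events).** Two finite Borel measures on
`NonemptyCompacts α` with the same mass, each dominated by the other in Hall form along `⊆` on the
joint hit events of finitely many open sets, are equal. [folklore] -/
theorem nonemptyCompacts_measure_eq_of_dominated_of_dominated'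
    {μ ν : Measure (NonemptyCompacts α)} [IsFiniteMeasure μ] (huniv : μ univ = ν univ)
    (h₁ : ∀ F : Finset (Set α), (∀ U ∈ F, IsOpen U) →
      μ {K : NonemptyCompacts α | ∀ U ∈ F, ((K : Set α) ∩ U).Nonempty} ≤
        ν {K' | ∃ K ∈ {K : NonemptyCompacts α | ∀ U ∈ F, ((K : Set α) ∩ U).Nonempty},
          (K : Set α) ⊆ K'})
    (h₂ : ∀ F : Finset (Set α), (∀ U ∈ F, IsOpen U) →
      ν {K : NonemptyCompacts α | ∀ U ∈ F, ((K : Set α) ∩ U).Nonempty} ≤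
        μ {K' | ∃ K ∈ {K : NonemptyCompacts α | ∀ U ∈ F, ((K : Set α) ∩ U).Nonempty},
          (K : Set α) ⊆ K'}) :
    μ = ν := by
  refine measure_eq_of_dominated_of_dominated_on_piSystem
    (r := fun K K' : NonemptyCompacts α => (K : Set α) ⊆ K') _
    measurableSpace_eq_generateFrom_setOf_forall_hits isPiSystem_setOf_forall_hits ?_ huniv ?_ ?_
  · rintro _ ⟨F, -, rfl⟩ K K' hK hKK' U hU
    exact (hK U hU).mono (inter_subset_inter_left U hKK')
  · rintro _ ⟨F, hF, rfl⟩
    exact h₁ F hF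
  · rintro _ ⟨F, hF, rfl⟩
    exact h₂ F hF

end HitEventsMeasure

/-! ### From two-sided domination to equality, through a monotone / antitone statistic -/

section Core

variable {X : Type*} [MeasurableSpace X] [StandardBorelSpace X]
  {α : Type*} [PseudoEMetricSpace α] [SecondCountableTopology α]
  [MeasurableSpace (NonemptyCompacts α)] [BorelSpace (NonemptyCompacts α)]
  [MeasurableSpace.CountablySeparated (NonemptyCompacts α)]

/-- **Steps (2) + (3) of the squeeze, monotone statistic.** If two probability laws `μ`, `λ` on a
standard Borel space dominate each other along a relation `T` on measurable sets
(`λ A ≤ μ (T[A])`, `μ A ≤ λ (T[A])`), a measurable compact-set-valued statistic `Φ` is monotone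
along `T` and injective on a measurable set carrying both laws, then `μ = λ`: the `Φ`-preimages of
the joint hit events are measurable `T`-up-sets, so the image laws agree on a generating π-system,
and the identification pulls back. [folklore] -/
theorem measure_eq_of_dominated_of_monotone_map {T : X → X → Prop} {Φ : X → NonemptyCompacts α}
    (hΦ : Measurable Φ) (hmono : ∀ x y, T x y → (Φ x : Set α) ⊆ Φ y) {S : Set X}
    (hS : MeasurableSet S) (hinj : InjOn Φ S) {μ lam : Measure X} [IsProbabilityMeasure μ]
    [IsProbabilityMeasure lam] (hμS : μ Sᶜ = 0) (hlamS : lam Sᶜ = 0)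
    (hlam : ∀ A : Set X, MeasurableSet A → lam A ≤ μ {y | ∃ x ∈ A, T x y})
    (hmu : ∀ A : Set X, MeasurableSet A → μ A ≤ lam {y | ∃ x ∈ A, T x y}) : μ = lam := by
  have hmap : μ.map Φ = lam.map Φ := by
    haveI : IsFiniteMeasure (μ.map Φ) := Measure.isFiniteMeasure_map μ Φ
    refine nonemptyCompacts_ext_of_forall_hits _ _ ?_ fun F hF => ?_
    · rw [Measure.map_apply hΦ MeasurableSet.univ, Measure.map_apply hΦ MeasurableSet.univ]
      simp
    set E : Set (NonemptyCompacts α) := {K | ∀ U ∈ F, ((K : Set α) ∩ U).Nonempty} with hE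
    have hEm : MeasurableSet E := by
      have hEq : E = ⋂ U ∈ F, {K : NonemptyCompacts α | Disjoint (K : Set α) U}ᶜ := by
        ext K
        simp only [hE, mem_setOf_eq, mem_iInter, mem_compl_iff, disjoint_iff_inter_eq_empty,
          nonempty_iff_ne_empty, ne_eq]
      rw [hEq]
      exact Finset.measurableSet_biInter F fun U hU =>
        (Literature.MeasureTheory.RandomSets.measurableSet_setOf_disjoint (hF U hU)).compl
    have hA : MeasurableSet (Φ ⁻¹' E) := hΦ hEm
    have hup : {y | ∃ x ∈ Φ ⁻¹' E, T x y} ⊆ Φ ⁻¹' E := by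
      rintro y ⟨x, hx, hxy⟩ U hU
      exact (hx U hU).mono (inter_subset_inter_left U (hmono x y hxy))
    rw [Measure.map_apply hΦ hEm, Measure.map_apply hΦ hEm]
    exact le_antisymm ((hmu _ hA).trans (measure_mono hup)) ((hlam _ hA).trans (measure_mono hup))
  exact measure_eq_of_map_eq_of_injOn hΦ hS hinj hμS hlamS hmap

/-- **Steps (2) + (3) of the squeeze, antitone statistic** (`T x y → Φ y ⊆ Φ x`), via the miss
events. [folklore] -/
theorem measure_eq_of_dominated_of_antitone_map {T : X → X → Prop} {Φ : X → NonemptyCompacts α}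
    (hΦ : Measurable Φ) (hanti : ∀ x y, T x y → (Φ y : Set α) ⊆ Φ x) {S : Set X}
    (hS : MeasurableSet S) (hinj : InjOn Φ S) {μ lam : Measure X} [IsProbabilityMeasure μ]
    [IsProbabilityMeasure lam] (hμS : μ Sᶜ = 0) (hlamS : lam Sᶜ = 0)
    (hlam : ∀ A : Set X, MeasurableSet A → lam A ≤ μ {y | ∃ x ∈ A, T x y})
    (hmu : ∀ A : Set X, MeasurableSet A → μ A ≤ lam {y | ∃ x ∈ A, T x y}) : μ = lam := by
  have hmap : μ.map Φ = lam.map Φ := by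
    haveI : IsFiniteMeasure (μ.map Φ) := Measure.isFiniteMeasure_map μ Φ
    refine Literature.MeasureTheory.RandomSets.ext_of_forall_measure_setOf_disjoint_eq _ _ ?_
      fun U hU => ?_
    · rw [Measure.map_apply hΦ MeasurableSet.univ, Measure.map_apply hΦ MeasurableSet.univ]
      simp
    set E : Set (NonemptyCompacts α) := {K | Disjoint (K : Set α) U} with hE
    have hEm : MeasurableSet E := Literature.MeasureTheory.RandomSets.measurableSet_setOf_disjoint hU
    have hA : MeasurableSet (Φ ⁻¹' E) := hΦ hEm
    have hup : {y | ∃ x ∈ Φ ⁻¹' E, T x y} ⊆ Φ ⁻¹' E := by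
      rintro y ⟨x, hx, hxy⟩
      exact Disjoint.mono_left (hanti x y hxy) hx
    rw [Measure.map_apply hΦ hEm, Measure.map_apply hΦ hEm]
    exact le_antisymm ((hmu _ hA).trans (measure_mono hup)) ((hlam _ hA).trans (measure_mono hup))
  exact measure_eq_of_map_eq_of_injOn hΦ hS hinj hμS hlamS hmap

end Core

/-! ### The assembled squeeze through a monotone / antitone compact-set statistic -/

section Assembled

variable {X : Type*} [PseudoMetricSpace X] [MeasurableSpace X] [BorelSpace X] [StandardBorelSpace X]
  {α : Type*} [PseudoEMetricSpace α] [SecondCountableTopology α]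
  [MeasurableSpace (NonemptyCompacts α)] [BorelSpace (NonemptyCompacts α)]
  [MeasurableSpace.CountablySeparated (NonemptyCompacts α)]

/-- **Squeeze through a monotone statistic.** Let `R` be a relation with closed graph on a metric
standard Borel space `X` (e.g. "the second chord lies weakly beyond the first"), `Φ : X → K(α)` a
measurable compact-set-valued statistic which is MONOTONE along `R` (`R x y → Φ x ⊆ Φ y`; e.g. a
side region) and injective on a measurable set `S`. If `μ`, `λ` are probability laws carried by
`S` (inner regular, e.g. `X` Polish), `lo n → λ`, `hi n → λ` weakly, and `lo n ≼_R μ ≼_R hi n` in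
Hall form on open sets for all large `n`, then `μ = λ`. [folklore] -/
theorem measure_eq_of_squeeze_of_monotone_map {R : X → X → Prop}
    (hR : IsClosed {p : X × X | R p.1 p.2}) {Φ : X → NonemptyCompacts α} (hΦ : Measurable Φ)
    (hmono : ∀ x y, R x y → (Φ x : Set α) ⊆ Φ y) {S : Set X} (hS : MeasurableSet S)
    (hinj : InjOn Φ S) {μ lam : Measure X} [IsProbabilityMeasure μ] [IsProbabilityMeasure lam]
    [μ.InnerRegularCompactLTTop] [lam.InnerRegularCompactLTTop] (hμS : μ Sᶜ = 0)
    (hlamS : lam Sᶜ = 0) {lo hi : ℕ → Measure X} [∀ n, IsProbabilityMeasure (lo n)]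
    [∀ n, IsProbabilityMeasure (hi n)]
    (hlo : ∀ f : X →ᵇ ℝ, Tendsto (fun n => ∫ x, f x ∂lo n) atTop (𝓝 (∫ x, f x ∂lam)))
    (hhi : ∀ f : X →ᵇ ℝ, Tendsto (fun n => ∫ x, f x ∂hi n) atTop (𝓝 (∫ x, f x ∂lam)))
    (h₁ : ∀ᶠ n in atTop, ∀ U : Set X, IsOpen U → lo n U ≤ μ {y | ∃ x ∈ U, R x y})
    (h₂ : ∀ᶠ n in atTop, ∀ U : Set X, IsOpen U → μ U ≤ hi n {y | ∃ x ∈ U, R x y}) :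
    μ = lam :=
  have hconst : ∀ f : X →ᵇ ℝ, Tendsto (fun _ : ℕ => ∫ x, f x ∂μ) atTop (𝓝 (∫ x, f x ∂μ)) :=
    fun _ => tendsto_const_nhds
  measure_eq_of_dominated_of_monotone_map hΦ hmono hS hinj hμS hlamS
    (fun _ hA => measure_le_relImage_of_forall_integral_tendsto (μs := lo) (νs := fun _ => μ)
      hR hlo hconst h₁ hA)
    (fun _ hA => measure_le_relImage_of_forall_integral_tendsto (μs := fun _ => μ) (νs := hi)
      hR hconst hhi h₂ hA)

/-- **Squeeze through an antitone statistic** (`R x y → Φ y ⊆ Φ x`; e.g. the OTHER side region):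
same conclusion, via the miss events. [folklore] -/
theorem measure_eq_of_squeeze_of_antitone_map {R : X → X → Prop}
    (hR : IsClosed {p : X × X | R p.1 p.2}) {Φ : X → NonemptyCompacts α} (hΦ : Measurable Φ)
    (hanti : ∀ x y, R x y → (Φ y : Set α) ⊆ Φ x) {S : Set X} (hS : MeasurableSet S)
    (hinj : InjOn Φ S) {μ lam : Measure X} [IsProbabilityMeasure μ] [IsProbabilityMeasure lam]
    [μ.InnerRegularCompactLTTop] [lam.InnerRegularCompactLTTop] (hμS : μ Sᶜ = 0)
    (hlamS : lam Sᶜ = 0) {lo hi : ℕ → Measure X} [∀ n, IsProbabilityMeasure (lo n)]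
    [∀ n, IsProbabilityMeasure (hi n)]
    (hlo : ∀ f : X →ᵇ ℝ, Tendsto (fun n => ∫ x, f x ∂lo n) atTop (𝓝 (∫ x, f x ∂lam)))
    (hhi : ∀ f : X →ᵇ ℝ, Tendsto (fun n => ∫ x, f x ∂hi n) atTop (𝓝 (∫ x, f x ∂lam)))
    (h₁ : ∀ᶠ n in atTop, ∀ U : Set X, IsOpen U → lo n U ≤ μ {y | ∃ x ∈ U, R x y})
    (h₂ : ∀ᶠ n in atTop, ∀ U : Set X, IsOpen U → μ U ≤ hi n {y | ∃ x ∈ U, R x y}) :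
    μ = lam :=
  have hconst : ∀ f : X →ᵇ ℝ, Tendsto (fun _ : ℕ => ∫ x, f x ∂μ) atTop (𝓝 (∫ x, f x ∂μ)) :=
    fun _ => tendsto_const_nhds
  measure_eq_of_dominated_of_antitone_map hΦ hanti hS hinj hμS hlamS
    (fun _ hA => measure_le_relImage_of_forall_integral_tendsto (μs := lo) (νs := fun _ => μ)
      hR hlo hconst h₁ hA)
    (fun _ hA => measure_le_relImage_of_forall_integral_tendsto (μs := fun _ => μ) (νs := hi)
      hR hconst hhi h₂ hA)

/-- **Squeeze through a monotone statistic, stage-dependent relations.** As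
`measure_eq_of_squeeze_of_monotone_map`, but the Hall inequalities at stage `n` hold along
relations `S₁ n` (lower) and `S₂ n` (upper) that are only asymptotically inside each member of a
decreasing sequence of closed relations `R k`, and the statistic is monotone along `⋂ₖ R k`. (The
form needed when the reference laws `lo n`, `hi n` are chordal laws toward targets `bₙ → b`, so
that the connecting arcs — and with them the left–right relation — depend on `n` and only their
limit, with the trivial connector, orders the side regions.) [folklore] -/
theorem measure_eq_of_squeeze_of_monotone_map_of_antitone {R : ℕ → X → X → Prop}
    (hR : ∀ k, IsClosed {p : X × X | R k p.1 p.2}) (hanti : ∀ k l, k ≤ l → ∀ x y, R l x y → R k x y)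
    {S₁ S₂ : ℕ → X → X → Prop} (hS₁ : ∀ k, ∀ᶠ n in atTop, ∀ x y, S₁ n x y → R k x y)
    (hS₂ : ∀ k, ∀ᶠ n in atTop, ∀ x y, S₂ n x y → R k x y)
    {Φ : X → NonemptyCompacts α} (hΦ : Measurable Φ)
    (hmono : ∀ x y, (∀ k, R k x y) → (Φ x : Set α) ⊆ Φ y) {S : Set X} (hS : MeasurableSet S)
    (hinj : InjOn Φ S) {μ lam : Measure X} [IsProbabilityMeasure μ] [IsProbabilityMeasure lam]
    [μ.InnerRegularCompactLTTop] [lam.InnerRegularCompactLTTop] (hμS : μ Sᶜ = 0)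
    (hlamS : lam Sᶜ = 0) {lo hi : ℕ → Measure X} [∀ n, IsProbabilityMeasure (lo n)]
    [∀ n, IsProbabilityMeasure (hi n)]
    (hlo : ∀ f : X →ᵇ ℝ, Tendsto (fun n => ∫ x, f x ∂lo n) atTop (𝓝 (∫ x, f x ∂lam)))
    (hhi : ∀ f : X →ᵇ ℝ, Tendsto (fun n => ∫ x, f x ∂hi n) atTop (𝓝 (∫ x, f x ∂lam)))
    (h₁ : ∀ᶠ n in atTop, ∀ U : Set X, IsOpen U → lo n U ≤ μ {y | ∃ x ∈ U, S₁ n x y})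
    (h₂ : ∀ᶠ n in atTop, ∀ U : Set X, IsOpen U → μ U ≤ hi n {y | ∃ x ∈ U, S₂ n x y}) :
    μ = lam :=
  have hconst : ∀ f : X →ᵇ ℝ, Tendsto (fun _ : ℕ => ∫ x, f x ∂μ) atTop (𝓝 (∫ x, f x ∂μ)) :=
    fun _ => tendsto_const_nhds
  measure_eq_of_dominated_of_monotone_map (T := fun x y => ∀ k, R k x y) hΦ hmono hS hinj hμS hlamS
    (fun _ hA => measure_le_relImage_of_forall_integral_tendsto_of_antitone (μs := lo)
      (νs := fun _ => μ) hR hanti hS₁ hlo hconst h₁ hA)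
    (fun _ hA => measure_le_relImage_of_forall_integral_tendsto_of_antitone (μs := fun _ => μ)
      (νs := hi) hR hanti hS₂ hconst hhi h₂ hA)

/-- **Squeeze through an antitone statistic, stage-dependent relations.** [folklore] -/
theorem measure_eq_of_squeeze_of_antitone_map_of_antitone {R : ℕ → X → X → Prop}
    (hR : ∀ k, IsClosed {p : X × X | R k p.1 p.2}) (hanti : ∀ k l, k ≤ l → ∀ x y, R l x y → R k x y)
    {S₁ S₂ : ℕ → X → X → Prop} (hS₁ : ∀ k, ∀ᶠ n in atTop, ∀ x y, S₁ n x y → R k x y)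
    (hS₂ : ∀ k, ∀ᶠ n in atTop, ∀ x y, S₂ n x y → R k x y)
    {Φ : X → NonemptyCompacts α} (hΦ : Measurable Φ)
    (hΦanti : ∀ x y, (∀ k, R k x y) → (Φ y : Set α) ⊆ Φ x) {S : Set X} (hS : MeasurableSet S)
    (hinj : InjOn Φ S) {μ lam : Measure X} [IsProbabilityMeasure μ] [IsProbabilityMeasure lam]
    [μ.InnerRegularCompactLTTop] [lam.InnerRegularCompactLTTop] (hμS : μ Sᶜ = 0)
    (hlamS : lam Sᶜ = 0) {lo hi : ℕ → Measure X} [∀ n, IsProbabilityMeasure (lo n)]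
    [∀ n, IsProbabilityMeasure (hi n)]
    (hlo : ∀ f : X →ᵇ ℝ, Tendsto (fun n => ∫ x, f x ∂lo n) atTop (𝓝 (∫ x, f x ∂lam)))
    (hhi : ∀ f : X →ᵇ ℝ, Tendsto (fun n => ∫ x, f x ∂hi n) atTop (𝓝 (∫ x, f x ∂lam)))
    (h₁ : ∀ᶠ n in atTop, ∀ U : Set X, IsOpen U → lo n U ≤ μ {y | ∃ x ∈ U, S₁ n x y})
    (h₂ : ∀ᶠ n in atTop, ∀ U : Set X, IsOpen U → μ U ≤ hi n {y | ∃ x ∈ U, S₂ n x y}) :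
    μ = lam :=
  have hconst : ∀ f : X →ᵇ ℝ, Tendsto (fun _ : ℕ => ∫ x, f x ∂μ) atTop (𝓝 (∫ x, f x ∂μ)) :=
    fun _ => tendsto_const_nhds
  measure_eq_of_dominated_of_antitone_map (T := fun x y => ∀ k, R k x y) hΦ hΦanti hS hinj hμS
    hlamS
    (fun _ hA => measure_le_relImage_of_forall_integral_tendsto_of_antitone (μs := lo)
      (νs := fun _ => μ) hR hanti hS₁ hlo hconst h₁ hA)
    (fun _ hA => measure_le_relImage_of_forall_integral_tendsto_of_antitone (μs := fun _ => μ)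
      (νs := hi) hR hanti hS₂ hconst hhi h₂ hA)

end Assembled

end Literature.Probability.RandomPlanarGeometry

end
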